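import Literature.NumberTheory.Connes2026.SeparatedSincRemainder
import HarnessLib

/-!
# Connes 1999 Thm VII.4, `k = ℚ`: the one-parameter family `P̂⁰_M Q₀(1) ϑ_t` with REAL shift `t` —
# (W1) a uniform absolute bound, (W0) basis independence, (W2) the limit `log p · g(−t)` of its even trace

LABEL (line 1): RH-FREE literature (theorems only; NO definition, NO named fact).  bears_on: LADDER-RH
W-C/W-P (C1 named-fact debt), cell `rh-crit`, sub-cell cc, overflow row O1 — the "annulus road" under
`Connes1999_thm_VII_4_rat`: the family package with an arbitrary real shift (the integer shifts `m log p` of the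
one-prime analysis become `s + Σ_q m_q log q` once several primes interact).  WHAT THIS IS NOT: any claim about
positivity, Weil's criterion or RH.

Sources.  A. Connes, Selecta Math. 5 (1999) [`Connes1999`], §VII Thm 4 and proof (29)–(33) (held text
`paper:arxiv-math_9811068`, p0013); M. Reed, B. Simon I (1972) [`ReedSimon1972`], Thm. VI.18, VI.24.

## What is proved (`Q₀ = Q_{1/p,1} = annulusProj p 1`, `P̂⁰_M = dualCutoffProj ∅ M`, `ϑ_t = scalingUnitary t`)

* `norm_family_le_one_real`, `diagCoeff_family_eq_shell_add_offShell_real`, `tendsto_tsum_inner_ring_real`,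
  `annulusValue_real` — the real-shift versions of the one-prime plumbing (value `log p · g(−t)`);
* `separatedRemainder_real` — (S1),(S0),(S2) for `ϑ(g)(1 − Q̃)P̂⁰_MQ₀ϑ_t`, real `t`;
* `offShell_real_of_separated` — (O1),(O0),(O2) for `ϑ(g)(1 − Q₀)P̂⁰_MQ₀ϑ_t`;
* **`family_real`** — `∃ C`, (W1) `Σ_i |d_g(P̂⁰_M Q₀ ϑ_t, f_i)| ≤ C` uniformly in `M, t` and the Hilbert basis
  `(f_i)` of `L²(ℝ)_ev`, (W0) basis independence, (W2) `Σ_i d_g(P̂⁰_M Q₀ ϑ_t, f_i) → log p · g(−t)` as `M → ∞`.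

No instance, notation or attribute; no `def`.
-/

noncomputable section

open _root_.MeasureTheory Complex Set Filter Function
open scoped Real Topology ComplexConjugate InnerProductSpace

namespace Literature.NumberTheory.Connes2026

open Literature.NumberTheory.LFunctions Literature.Analysis.OperatorTheory
open Literature.NumberTheory.ConnesConsani
open Literature.NumberTheory.ConnesConsani2024
open Literature.NumberTheory.ConnesConsani2021 hiding cutoffProj cutoffProj_coeFn

variable (p : ℕ) [hp : Fact p.Prime]

/-! ## §1. Real-shift plumbing -/

omit hp in
/-- `‖P̂⁰_M Q₀ ϑ_t‖ ≤ 1`. [cite: Connes1999, §VII eqs. (12)–(13) (arXiv p0013)] -/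
theorem norm_family_le_one_real (M t : ℝ) :
    ‖dualCutoffProj ∅ M ∘L (annulusProj p 1 ∘L scalingUnitary t)‖ ≤ 1 := by
  refine ContinuousLinearMap.opNorm_le_bound _ zero_le_one fun x => ?_
  rw [one_mul, ContinuousLinearMap.comp_apply, ContinuousLinearMap.comp_apply]
  refine (norm_dualCutoffProj_empty_le M _).trans ?_
  refine ((norm_annulusProj_le p 1) |> fun h => (ContinuousLinearMap.le_of_opNorm_le _ h _)).trans ?_
  rw [one_mul, norm_scalingUnitary_apply]

omit hp in
/-- The diagonal coefficient of the family splits into shell and off-shell parts (real shift). [cite: Connes1999, §VII proof of Thm 4 eqs. (29)–(33) (arXiv p0013)] -/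
theorem diagCoeff_family_eq_shell_add_offShell_real (g : ℝ → ℂ)
    (Q : Lp ℂ 2 (volume : Measure ℝ) →L[ℂ] Lp ℂ 2 (volume : Measure ℝ)) (M t : ℝ) (e : Lp ℂ 2 (volume : Measure ℝ)) :
    diagCoeff g (dualCutoffProj ∅ M * annulusProj p 1 * scalingUnitary t) e =
      ⟪e, (scalingOp g ∘L (Q ∘L (dualCutoffProj ∅ M ∘L (annulusProj p 1 ∘L scalingUnitary t)))) e⟫_ℂ +
      ⟪e, (scalingOp g ∘L ((1 - Q) ∘L (dualCutoffProj ∅ M ∘L (annulusProj p 1 ∘L scalingUnitary t)))) e⟫_ℂ := by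
  rw [diagCoeff, ← inner_add_right]
  congr 1
  simp only [ContinuousLinearMap.comp_apply, mul_apply_eq_comp, sub_apply, one_apply_eq_self, map_sub]
  abel

omit hp in
/-- A ring piece vanishes in the limit (real shift). [cite: Connes1999, §VII proof of Thm 4 eqs. (29)–(33) (arXiv p0013)] -/
theorem tendsto_tsum_inner_ring_real {g : ℝ → ℂ} (hg : IsWeilTest g) {a b : ℝ} (ha : 0 < a) (hab : a ≤ b)
    (hQ : shellProj a b * annulusProj p 1 = 0) (t : ℝ) {ι : Type*}
    (e : HilbertBasis ι ℂ (evenPart : Submodule ℂ (Lp ℂ 2 (volume : Measure ℝ)))) :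
    Tendsto (fun M : ℝ => ∑' i, ⟪((e i : evenPart) : Lp ℂ 2 (volume : Measure ℝ)),
        (scalingOp g ∘L (shellProj a b ∘L
          (dualCutoffProj ∅ M ∘L (annulusProj p 1 ∘L scalingUnitary t))))
          ((e i : evenPart) : Lp ℂ 2 (volume : Measure ℝ))⟫_ℂ) atTop (𝓝 0) := by
  have h := tendsto_tsum_inner_scalingOp_shellProj_dualCutoff hg.1 hg.2 ha hab
    (annulusProj p 1 ∘L scalingUnitary t) e
  have h0 : shellProj a b ∘L (annulusProj p 1 ∘L scalingUnitary t) = 0 := by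
    rw [← ContinuousLinearMap.comp_assoc]
    change (shellProj a b * annulusProj p 1) ∘L scalingUnitary t = 0
    rw [hQ, ContinuousLinearMap.zero_comp]
  rw [h0, ContinuousLinearMap.comp_zero] at h
  simpa only [zero_apply, inner_zero_right, tsum_zero] using h

/-- **The trace value with a real shift**: `Σ_i ⟨f_i, (ϑ(g) ∘ Q₀ ∘ (Q₀ ∘ ϑ_t)) f_i⟩ = log p · g(−t)`. [cite: Connes1999, §VII proof of Thm 4 eqs. (29)–(33) (arXiv p0013)] -/
theorem annulusValue_real {g : ℝ → ℂ} (hg : IsWeilTest g) (t : ℝ) (ι : Type)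
    (f : HilbertBasis ι ℂ (evenPart : Submodule ℂ (Lp ℂ 2 (volume : Measure ℝ)))) :
    ∑' i, ⟪((f i : evenPart) : Lp ℂ 2 (volume : Measure ℝ)),
        (scalingOp g ∘L (shellProj (p : ℝ)⁻¹ 1 ∘L (annulusProj p 1 ∘L scalingUnitary t)))
          ((f i : evenPart) : Lp ℂ 2 (volume : Measure ℝ))⟫_ℂ = (Real.log p : ℂ) * g (-t) := by
  have hab : (p : ℝ)⁻¹ ≤ 1 := inv_le_one_of_one_le₀ (by exact_mod_cast hp.out.one_lt.le)
  have hQ : annulusProj p 1 = shellProj (p : ℝ)⁻¹ 1 := by rw [annulusProj_eq_shellProj, one_div]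
  rw [hQ]
  simp_rw [inner_scalingOp_shellProj_scalingUnitary_eq (hg.1.continuous.integrable_of_hasCompactSupport hg.2)
    hab t f]
  exact traceValue_translate p hg t ι (f.scalingConj (-t))

/-! ## §2. (S1), (S0), (S2) with a real shift -/

/-- **The separated remainder with a real shift**: uniform bound (S1), basis independence (S0), vanishing limit
(S2) for the diagonal series of `ϑ(g)(1 − Q̃)P̂⁰_MQ₀ϑ_t`, `t ∈ ℝ`. [cite: Connes1999, §VII Thm 4 and proof eqs. (29)–(33) (arXiv p0013); ReedSimon1972, Thm. VI.18 and VI.24, PDF pp. 196–199] -/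
theorem separatedRemainder_real {g : ℝ → ℂ} (hg : IsWeilTest g) {δ : ℝ} (hδ : 0 < δ) :
    ∃ C : ℝ,
    (∀ (M : ℝ) (m : ℝ) (ι : Type) (f : HilbertBasis ι ℂ (evenPart : Submodule ℂ (Lp ℂ 2 (volume : Measure ℝ)))),
      Summable (fun i => ‖⟪((f i : evenPart) : Lp ℂ 2 (volume : Measure ℝ)),
        (scalingOp g ∘L ((1 - shellProj ((p : ℝ)⁻¹ * Real.exp (-δ)) (Real.exp δ)) ∘L
          (dualCutoffProj ∅ M ∘L (annulusProj p 1 ∘L scalingUnitary m))))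
          ((f i : evenPart) : Lp ℂ 2 (volume : Measure ℝ))⟫_ℂ‖) ∧
      ∑' i, ‖⟪((f i : evenPart) : Lp ℂ 2 (volume : Measure ℝ)),
        (scalingOp g ∘L ((1 - shellProj ((p : ℝ)⁻¹ * Real.exp (-δ)) (Real.exp δ)) ∘L
          (dualCutoffProj ∅ M ∘L (annulusProj p 1 ∘L scalingUnitary m))))
          ((f i : evenPart) : Lp ℂ 2 (volume : Measure ℝ))⟫_ℂ‖ ≤ C) ∧
    (∀ (M : ℝ) (m : ℝ) (ι : Type) (f : HilbertBasis ι ℂ (evenPart : Submodule ℂ (Lp ℂ 2 (volume : Measure ℝ)))) (ι' : Type)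
      (f' : HilbertBasis ι' ℂ (evenPart : Submodule ℂ (Lp ℂ 2 (volume : Measure ℝ)))),
      ∑' i, ⟪((f i : evenPart) : Lp ℂ 2 (volume : Measure ℝ)),
        (scalingOp g ∘L ((1 - shellProj ((p : ℝ)⁻¹ * Real.exp (-δ)) (Real.exp δ)) ∘L
          (dualCutoffProj ∅ M ∘L (annulusProj p 1 ∘L scalingUnitary m))))
          ((f i : evenPart) : Lp ℂ 2 (volume : Measure ℝ))⟫_ℂ =
      ∑' i, ⟪((f' i : evenPart) : Lp ℂ 2 (volume : Measure ℝ)),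
        (scalingOp g ∘L ((1 - shellProj ((p : ℝ)⁻¹ * Real.exp (-δ)) (Real.exp δ)) ∘L
          (dualCutoffProj ∅ M ∘L (annulusProj p 1 ∘L scalingUnitary m))))
          ((f' i : evenPart) : Lp ℂ 2 (volume : Measure ℝ))⟫_ℂ) ∧
    (∀ (m : ℝ) (ι : Type) (f : HilbertBasis ι ℂ (evenPart : Submodule ℂ (Lp ℂ 2 (volume : Measure ℝ)))),
      Tendsto (fun M : ℝ => ∑' i, ⟪((f i : evenPart) : Lp ℂ 2 (volume : Measure ℝ)),
        (scalingOp g ∘L ((1 - shellProj ((p : ℝ)⁻¹ * Real.exp (-δ)) (Real.exp δ)) ∘L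
          (dualCutoffProj ∅ M ∘L (annulusProj p 1 ∘L scalingUnitary m))))
          ((f i : evenPart) : Lp ℂ 2 (volume : Measure ℝ))⟫_ℂ) atTop (𝓝 0)) := by
  haveI : CompleteSpace (evenPart : Submodule ℂ (Lp ℂ 2 (volume : Measure ℝ))) := completeSpace_evenPart
  have hgi : Integrable g := hg.1.continuous.integrable_of_hasCompactSupport hg.2
  obtain ⟨lam, σ, u₀, w₀, nu, nw, u, w, hσ, hu₀, hw₀, hu_ae, hw_ae, hnu, hnw, hsum, hexp⟩ :=
    exists_rankOne_expansion_separatedSinc p hδ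
  -- abbreviations
  set T : ℝ → (Lp ℂ 2 (volume : Measure ℝ) →L[ℂ] Lp ℂ 2 (volume : Measure ℝ)) := fun M =>
    ((1 : Lp ℂ 2 (volume : Measure ℝ) →L[ℂ] Lp ℂ 2 (volume : Measure ℝ)) -
        shellProj ((p : ℝ)⁻¹ * Real.exp (-δ)) (Real.exp δ)) ∘L
      (dualCutoffProj ∅ M ∘L shellProj (p : ℝ)⁻¹ 1) with hT
  have hQ0 : annulusProj p 1 = shellProj (p : ℝ)⁻¹ 1 := by rw [annulusProj_eq_shellProj, one_div]
  have hA : ∀ (M : ℝ) (m : ℝ) (x : Lp ℂ 2 (volume : Measure ℝ)),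
      (scalingOp g ∘L ((1 - shellProj ((p : ℝ)⁻¹ * Real.exp (-δ)) (Real.exp δ)) ∘L
          (dualCutoffProj ∅ M ∘L (annulusProj p 1 ∘L scalingUnitary m)))) x =
      scalingOp g (T M (scalingUnitary m x)) := by
    intro M m x
    simp only [hT, hQ0, ContinuousLinearMap.comp_apply]
  have hA0 : ∀ (M : ℝ), M ≤ 0 → ∀ (m : ℝ) (x : Lp ℂ 2 (volume : Measure ℝ)),
      (scalingOp g ∘L ((1 - shellProj ((p : ℝ)⁻¹ * Real.exp (-δ)) (Real.exp δ)) ∘L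
          (dualCutoffProj ∅ M ∘L (annulusProj p 1 ∘L scalingUnitary m)))) x = 0 := by
    intro M hM m x
    simp only [ContinuousLinearMap.comp_apply, dualCutoffProj_empty_of_nonpos hM, zero_apply,
      map_zero]
  -- the `M`-free nuclear norm
  have hsumM : ∀ M, Summable (fun k => ‖lam k‖ * (‖u M k‖ ^ 2 + ‖w M k‖ ^ 2)) := fun M => by
    simp only [hnu, hnw]; exact hsum
  set C₀ : ℝ := ∑' k, ‖lam k‖ * (nu k ^ 2 + nw k ^ 2) with hC₀
  have hC₀0 : 0 ≤ C₀ := tsum_nonneg fun k => by positivity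
  have htsumM : ∀ M, ∑' k, ‖lam k‖ * (‖u M k‖ ^ 2 + ‖w M k‖ ^ 2) = C₀ := fun M => by
    simp only [hnu, hnw, hC₀]
  have hU1 : ∀ m : ℝ, ‖scalingUnitary m‖ ^ 2 ≤ 1 := fun m =>
    pow_le_one₀ (norm_nonneg _) (norm_scalingUnitary_le_one _)
  -- the key consequence of the sandwich theorem, for `M > 0`
  have key : ∀ (M : ℝ), 0 < M → ∀ (m : ℝ) (ι : Type)
      (f : HilbertBasis ι ℂ (evenPart : Submodule ℂ (Lp ℂ 2 (volume : Measure ℝ)))),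
      (Summable fun i => ‖⟪((f i : evenPart) : Lp ℂ 2 (volume : Measure ℝ)),
        scalingOp g (T M (scalingUnitary m ((f i : evenPart) : Lp ℂ 2 (volume : Measure ℝ))))⟫_ℂ‖) ∧
      ∑' i, ‖⟪((f i : evenPart) : Lp ℂ 2 (volume : Measure ℝ)),
        scalingOp g (T M (scalingUnitary m ((f i : evenPart) : Lp ℂ 2 (volume : Measure ℝ))))⟫_ℂ‖ ≤
        (‖scalingOp g‖ ^ 2 + ‖scalingUnitary m‖ ^ 2) * ∑' k, ‖lam k‖ * (‖u M k‖ ^ 2 + ‖w M k‖ ^ 2) ∧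
      ∑' i, ⟪((f i : evenPart) : Lp ℂ 2 (volume : Measure ℝ)),
        scalingOp g (T M (scalingUnitary m ((f i : evenPart) : Lp ℂ 2 (volume : Measure ℝ))))⟫_ℂ =
        ∑' k, lam k * ⟪ContinuousLinearMap.adjoint (scalingUnitary m) (w M k), (evenPart : Submodule ℂ (Lp ℂ 2 (volume : Measure ℝ))).starProjection (scalingOp g (u M k))⟫_ℂ :=
    fun M hM m ι f => rankOne_sandwich_diag_coe f (hexp M hM) (hsumM M)
  refine ⟨(‖scalingOp g‖ ^ 2 + 1) * C₀, ?_, ?_, ?_⟩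
  · -- (S1)
    intro M m ι f
    by_cases hM : 0 < M
    · obtain ⟨h1, h2, -⟩ := key M hM m ι f
      simp only [hA]
      refine ⟨h1, h2.trans ?_⟩
      rw [htsumM]
      have hX0 : 0 ≤ ‖scalingOp g‖ ^ 2 := sq_nonneg _
      nlinarith [hU1 m, hC₀0]
    · have hM' : M ≤ 0 := not_lt.mp hM
      simp only [hA0 M hM' m, inner_zero_right, norm_zero, tsum_zero]
      exact ⟨summable_zero, by positivity⟩
  · -- (S0)
    intro M m ι f ι' f'
    by_cases hM : 0 < M
    · simp only [hA]
      rw [(key M hM m ι f).2.2, (key M hM m ι' f').2.2]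
    · have hM' : M ≤ 0 := not_lt.mp hM
      simp only [hA0 M hM' m, inner_zero_right, tsum_zero]
  · -- (S2)
    intro m ι f
    have hterm : ∀ k, Tendsto (fun M : ℝ =>
        lam k * ⟪ContinuousLinearMap.adjoint (scalingUnitary m) (w M k), (evenPart : Submodule ℂ (Lp ℂ 2 (volume : Measure ℝ))).starProjection (scalingOp g (u M k))⟫_ℂ)
        atTop (𝓝 0) := by
      intro k
      have h := tendsto_inner_adjoint_starProjection_scalingOp hgi m (hw₀ k) (hu₀ k) (hσ k)
        (fun M => hw_ae M k) (fun M => hu_ae M k)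
      simpa only [mul_zero] using h.const_mul (lam k)
    have hbound : ∀ᶠ M : ℝ in atTop, ∀ k,
        ‖lam k * ⟪ContinuousLinearMap.adjoint (scalingUnitary m) (w M k), (evenPart : Submodule ℂ (Lp ℂ 2 (volume : Measure ℝ))).starProjection (scalingOp g (u M k))⟫_ℂ‖ ≤
          ‖scalingOp g‖ * (‖lam k‖ * (nu k ^ 2 + nw k ^ 2)) := by
      refine Eventually.of_forall fun M k => ?_
      rw [norm_mul]
      have h1 : ‖ContinuousLinearMap.adjoint (scalingUnitary m) (w M k)‖ = nw k := by
        rw [adjoint_scalingUnitary, norm_scalingUnitary_apply, hnw]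
      have h2 : ‖(evenPart : Submodule ℂ (Lp ℂ 2 (volume : Measure ℝ))).starProjection (scalingOp g (u M k))‖ ≤
          ‖scalingOp g‖ * nu k := by
        refine (Submodule.norm_starProjection_apply_le _ _).trans ?_
        rw [← hnu M k]; exact (scalingOp g).le_opNorm _
      have h3 : ‖⟪ContinuousLinearMap.adjoint (scalingUnitary m) (w M k), (evenPart : Submodule ℂ (Lp ℂ 2 (volume : Measure ℝ))).starProjection (scalingOp g (u M k))⟫_ℂ‖ ≤
          nw k * (‖scalingOp g‖ * nu k) := by
        refine (norm_inner_le_norm _ _).trans ?_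
        rw [h1]
        exact mul_le_mul_of_nonneg_left h2 (by rw [← hnw M k]; exact norm_nonneg _)
      have hnu0 : 0 ≤ nu k := by rw [← hnu M k]; exact norm_nonneg _
      have hnw0 : 0 ≤ nw k := by rw [← hnw M k]; exact norm_nonneg _
      have hX0 : 0 ≤ ‖scalingOp g‖ := norm_nonneg _
      have hl0 : 0 ≤ ‖lam k‖ := norm_nonneg _
      calc ‖lam k‖ * ‖⟪ContinuousLinearMap.adjoint (scalingUnitary m) (w M k), (evenPart : Submodule ℂ (Lp ℂ 2 (volume : Measure ℝ))).starProjection (scalingOp g (u M k))⟫_ℂ‖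
          ≤ ‖lam k‖ * (nw k * (‖scalingOp g‖ * nu k)) := mul_le_mul_of_nonneg_left h3 hl0
        _ ≤ ‖scalingOp g‖ * (‖lam k‖ * (nu k ^ 2 + nw k ^ 2)) := by
            nlinarith [sq_nonneg (nu k - nw k), mul_nonneg hX0 hl0, mul_nonneg (mul_nonneg hX0 hl0) (sq_nonneg (nu k - nw k))]
    have hV := tendsto_tsum_of_dominated_convergence (hsum.mul_left ‖scalingOp g‖) hterm hbound
    rw [tsum_zero] at hV
    refine hV.congr' ?_
    filter_upwards [eventually_gt_atTop (0 : ℝ)] with M hM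
    simp only [hA]
    exact (key M hM m ι f).2.2.symm



/-! ## §3. (O1), (O0), (O2) with a real shift -/

/-- **The off-shell remainder with a real shift** from the separated one: `1 − Q₀ = Q_in + Q_out + (1 − Q̃)` with the
margin `δ`, the two ring pieces being shell-localised. [cite: Connes1999, §VII Thm 4 and proof eqs. (29)–(33) (arXiv p0013)] -/
theorem offShell_real_of_separated {g : ℝ → ℂ} (hg : IsWeilTest g) {δ : ℝ} (hδ : 0 < δ)
    {C : ℝ}
    (hS1 : ∀ (M : ℝ) (m : ℝ) (ι : Type) (f : HilbertBasis ι ℂ (evenPart : Submodule ℂ (Lp ℂ 2 (volume : Measure ℝ)))),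
      Summable (fun i => ‖⟪((f i : evenPart) : Lp ℂ 2 (volume : Measure ℝ)),
        (scalingOp g ∘L ((1 - shellProj ((p : ℝ)⁻¹ * Real.exp (-δ)) (Real.exp δ)) ∘L
          (dualCutoffProj ∅ M ∘L (annulusProj p 1 ∘L scalingUnitary m))))
          ((f i : evenPart) : Lp ℂ 2 (volume : Measure ℝ))⟫_ℂ‖) ∧
      ∑' i, ‖⟪((f i : evenPart) : Lp ℂ 2 (volume : Measure ℝ)),
        (scalingOp g ∘L ((1 - shellProj ((p : ℝ)⁻¹ * Real.exp (-δ)) (Real.exp δ)) ∘L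
          (dualCutoffProj ∅ M ∘L (annulusProj p 1 ∘L scalingUnitary m))))
          ((f i : evenPart) : Lp ℂ 2 (volume : Measure ℝ))⟫_ℂ‖ ≤ C)
    (hS0 : ∀ (M : ℝ) (m : ℝ) (ι : Type) (f : HilbertBasis ι ℂ (evenPart : Submodule ℂ (Lp ℂ 2 (volume : Measure ℝ)))) (ι' : Type)
      (f' : HilbertBasis ι' ℂ (evenPart : Submodule ℂ (Lp ℂ 2 (volume : Measure ℝ)))),
      ∑' i, ⟪((f i : evenPart) : Lp ℂ 2 (volume : Measure ℝ)),
        (scalingOp g ∘L ((1 - shellProj ((p : ℝ)⁻¹ * Real.exp (-δ)) (Real.exp δ)) ∘L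
          (dualCutoffProj ∅ M ∘L (annulusProj p 1 ∘L scalingUnitary m))))
          ((f i : evenPart) : Lp ℂ 2 (volume : Measure ℝ))⟫_ℂ =
      ∑' i, ⟪((f' i : evenPart) : Lp ℂ 2 (volume : Measure ℝ)),
        (scalingOp g ∘L ((1 - shellProj ((p : ℝ)⁻¹ * Real.exp (-δ)) (Real.exp δ)) ∘L
          (dualCutoffProj ∅ M ∘L (annulusProj p 1 ∘L scalingUnitary m))))
          ((f' i : evenPart) : Lp ℂ 2 (volume : Measure ℝ))⟫_ℂ)
    (hS2 : ∀ (m : ℝ) (ι : Type) (f : HilbertBasis ι ℂ (evenPart : Submodule ℂ (Lp ℂ 2 (volume : Measure ℝ)))),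
      Tendsto (fun M : ℝ => ∑' i, ⟪((f i : evenPart) : Lp ℂ 2 (volume : Measure ℝ)),
        (scalingOp g ∘L ((1 - shellProj ((p : ℝ)⁻¹ * Real.exp (-δ)) (Real.exp δ)) ∘L
          (dualCutoffProj ∅ M ∘L (annulusProj p 1 ∘L scalingUnitary m))))
          ((f i : evenPart) : Lp ℂ 2 (volume : Measure ℝ))⟫_ℂ) atTop (𝓝 0))
    :
    ∃ C' : ℝ,
    (∀ (M : ℝ) (m : ℝ) (ι : Type) (f : HilbertBasis ι ℂ (evenPart : Submodule ℂ (Lp ℂ 2 (volume : Measure ℝ)))),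
      Summable (fun i => ‖⟪((f i : evenPart) : Lp ℂ 2 (volume : Measure ℝ)),
        (scalingOp g ∘L ((1 - shellProj (p : ℝ)⁻¹ 1) ∘L
          (dualCutoffProj ∅ M ∘L (annulusProj p 1 ∘L scalingUnitary m))))
          ((f i : evenPart) : Lp ℂ 2 (volume : Measure ℝ))⟫_ℂ‖) ∧
      ∑' i, ‖⟪((f i : evenPart) : Lp ℂ 2 (volume : Measure ℝ)),
        (scalingOp g ∘L ((1 - shellProj (p : ℝ)⁻¹ 1) ∘L
          (dualCutoffProj ∅ M ∘L (annulusProj p 1 ∘L scalingUnitary m))))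
          ((f i : evenPart) : Lp ℂ 2 (volume : Measure ℝ))⟫_ℂ‖ ≤ C') ∧
    (∀ (M : ℝ) (m : ℝ) (ι : Type) (f : HilbertBasis ι ℂ (evenPart : Submodule ℂ (Lp ℂ 2 (volume : Measure ℝ)))) (ι' : Type)
      (f' : HilbertBasis ι' ℂ (evenPart : Submodule ℂ (Lp ℂ 2 (volume : Measure ℝ)))),
      ∑' i, ⟪((f i : evenPart) : Lp ℂ 2 (volume : Measure ℝ)),
        (scalingOp g ∘L ((1 - shellProj (p : ℝ)⁻¹ 1) ∘L
          (dualCutoffProj ∅ M ∘L (annulusProj p 1 ∘L scalingUnitary m))))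
          ((f i : evenPart) : Lp ℂ 2 (volume : Measure ℝ))⟫_ℂ =
      ∑' i, ⟪((f' i : evenPart) : Lp ℂ 2 (volume : Measure ℝ)),
        (scalingOp g ∘L ((1 - shellProj (p : ℝ)⁻¹ 1) ∘L
          (dualCutoffProj ∅ M ∘L (annulusProj p 1 ∘L scalingUnitary m))))
          ((f' i : evenPart) : Lp ℂ 2 (volume : Measure ℝ))⟫_ℂ) ∧
    (∀ (m : ℝ) (ι : Type) (f : HilbertBasis ι ℂ (evenPart : Submodule ℂ (Lp ℂ 2 (volume : Measure ℝ)))),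
      Tendsto (fun M : ℝ => ∑' i, ⟪((f i : evenPart) : Lp ℂ 2 (volume : Measure ℝ)),
        (scalingOp g ∘L ((1 - shellProj (p : ℝ)⁻¹ 1) ∘L
          (dualCutoffProj ∅ M ∘L (annulusProj p 1 ∘L scalingUnitary m))))
          ((f i : evenPart) : Lp ℂ 2 (volume : Measure ℝ))⟫_ℂ) atTop (𝓝 0)) := by
  have hp1 : (1 : ℝ) < p := by exact_mod_cast hp.out.one_lt
  have hp0 : (0 : ℝ) < p := by linarith
  have hpi : (0 : ℝ) < (p : ℝ)⁻¹ := inv_pos.mpr hp0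
  have hpi1 : (p : ℝ)⁻¹ ≤ 1 := inv_le_one_of_one_le₀ hp1.le
  have heδ : Real.exp (-δ) < 1 := Real.exp_lt_one_iff.mpr (by linarith)
  have heδ' : 1 ≤ Real.exp δ := Real.one_le_exp hδ.le
  -- the two rings `Q_in = Q_{e^{-δ}/p, 1/p}`, `Q_out = Q_{1, e^δ}`
  have hin : (0 : ℝ) < (p : ℝ)⁻¹ * Real.exp (-δ) := mul_pos hpi (Real.exp_pos _)
  have hin' : (p : ℝ)⁻¹ * Real.exp (-δ) ≤ (p : ℝ)⁻¹ := mul_le_of_le_one_right hpi.le heδ.le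
  have hQ0 : annulusProj p 1 = shellProj (p : ℝ)⁻¹ 1 := by rw [annulusProj_eq_shellProj, one_div]
  have hQin : shellProj ((p : ℝ)⁻¹ * Real.exp (-δ)) (p : ℝ)⁻¹ * annulusProj p 1 = 0 := by
    rw [hQ0]; exact shellProj_mul_shellProj_of_le hin' hpi1
  have hQout : shellProj 1 (Real.exp δ) * annulusProj p 1 = 0 := by
    rw [hQ0]; exact shellProj_mul_shellProj_of_le' hpi1 heδ'
  obtain ⟨Cin, hCin0, hIn⟩ := exists_bound_tsum_norm_inner_scalingOp_shellProj hg.1 hg.2 hin hin'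
  obtain ⟨Cout, hCout0, hOut⟩ := exists_bound_tsum_norm_inner_scalingOp_shellProj hg.1 hg.2 one_pos heδ'
  -- abbreviations
  have hYn : ∀ (M : ℝ) (m : ℝ), ‖dualCutoffProj ∅ M ∘L (annulusProj p 1 ∘L scalingUnitary m)‖ ≤ 1 :=
    fun M m => norm_family_le_one_real p M m
  -- the decomposition of the off-shell coefficient
  have hdec : ∀ (M : ℝ) (m : ℝ) (x : Lp ℂ 2 (volume : Measure ℝ)),
      ⟪x, (scalingOp g ∘L ((1 - shellProj (p : ℝ)⁻¹ 1) ∘L (dualCutoffProj ∅ M ∘L (annulusProj p 1 ∘L scalingUnitary m)))) x⟫_ℂ =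
      ⟪x, (scalingOp g ∘L (shellProj ((p : ℝ)⁻¹ * Real.exp (-δ)) (p : ℝ)⁻¹ ∘L (dualCutoffProj ∅ M ∘L (annulusProj p 1 ∘L scalingUnitary m)))) x⟫_ℂ +
      ⟪x, (scalingOp g ∘L (shellProj 1 (Real.exp δ) ∘L (dualCutoffProj ∅ M ∘L (annulusProj p 1 ∘L scalingUnitary m)))) x⟫_ℂ +
      ⟪x, (scalingOp g ∘L ((1 - shellProj ((p : ℝ)⁻¹ * Real.exp (-δ)) (Real.exp δ)) ∘L (dualCutoffProj ∅ M ∘L (annulusProj p 1 ∘L scalingUnitary m)))) x⟫_ℂ := by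
    intro M m x
    rw [one_sub_shellProj_eq_add ((p : ℝ)⁻¹ * Real.exp (-δ)) (p : ℝ)⁻¹ 1 (Real.exp δ),
      ContinuousLinearMap.add_comp, ContinuousLinearMap.add_comp, ContinuousLinearMap.comp_add,
      ContinuousLinearMap.comp_add]
    simp only [add_apply, inner_add_right]
  refine ⟨Cin + Cout + C, ?_, ?_, ?_⟩
  · -- (O1)
    intro M m ι' f
    have h1 := hIn (dualCutoffProj ∅ M ∘L (annulusProj p 1 ∘L scalingUnitary m)) ι' f
    have h2 := hOut (dualCutoffProj ∅ M ∘L (annulusProj p 1 ∘L scalingUnitary m)) ι' f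
    have h3 := hS1 M m ι' f
    have hb : ∀ i, ‖⟪((f i : evenPart) : Lp ℂ 2 (volume : Measure ℝ)), (scalingOp g ∘L ((1 - shellProj (p : ℝ)⁻¹ 1) ∘L (dualCutoffProj ∅ M ∘L (annulusProj p 1 ∘L scalingUnitary m)))) ((f i : evenPart) : Lp ℂ 2 (volume : Measure ℝ))⟫_ℂ‖ ≤
        ‖⟪((f i : evenPart) : Lp ℂ 2 (volume : Measure ℝ)), (scalingOp g ∘L (shellProj ((p : ℝ)⁻¹ * Real.exp (-δ)) (p : ℝ)⁻¹ ∘L (dualCutoffProj ∅ M ∘L (annulusProj p 1 ∘L scalingUnitary m)))) ((f i : evenPart) : Lp ℂ 2 (volume : Measure ℝ))⟫_ℂ‖ + ‖⟪((f i : evenPart) : Lp ℂ 2 (volume : Measure ℝ)), (scalingOp g ∘L (shellProj 1 (Real.exp δ) ∘L (dualCutoffProj ∅ M ∘L (annulusProj p 1 ∘L scalingUnitary m)))) ((f i : evenPart) : Lp ℂ 2 (volume : Measure ℝ))⟫_ℂ‖ + ‖⟪((f i : evenPart) : Lp ℂ 2 (volume : Measure ℝ)), (scalingOp g ∘L ((1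 - shellProj ((p : ℝ)⁻¹ * Real.exp (-δ)) (Real.exp δ)) ∘L (dualCutoffProj ∅ M ∘L (annulusProj p 1 ∘L scalingUnitary m)))) ((f i : evenPart) : Lp ℂ 2 (volume : Measure ℝ))⟫_ℂ‖ := fun i => by
      rw [hdec]
      exact (norm_add_le _ _).trans (add_le_add (norm_add_le _ _) le_rfl)
    have h123 : Summable fun i => ‖⟪((f i : evenPart) : Lp ℂ 2 (volume : Measure ℝ)), (scalingOp g ∘L (shellProj ((p : ℝ)⁻¹ * Real.exp (-δ)) (p : ℝ)⁻¹ ∘L (dualCutoffProj ∅ M ∘L (annulusProj p 1 ∘L scalingUnitary m)))) ((f i : evenPart) : Lp ℂ 2 (volume : Measure ℝ))⟫_ℂ‖ + ‖⟪((f i : evenPart) : Lp ℂ 2 (volume : Measure ℝ)), (scalingOp g ∘L (shellProj 1 (Real.exp δ) ∘L (dualCutoffProj ∅ M ∘L (annulusProj p 1 ∘L scalingUnitary m)))) ((f i : evenPart) : Lp ℂ 2 (volume : Measure ℝ))⟫_ℂ‖ + ‖⟪((f i : evenPart) : Lp ℂ 2 (volume : Measure ℝ)), (scalingOp g ∘L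 ((1 - shellProj ((p : ℝ)⁻¹ * Real.exp (-δ)) (Real.exp δ)) ∘L (dualCutoffProj ∅ M ∘L (annulusProj p 1 ∘L scalingUnitary m)))) ((f i : evenPart) : Lp ℂ 2 (volume : Measure ℝ))⟫_ℂ‖ := (h1.1.add h2.1).add h3.1
    have hO : Summable fun i => ‖⟪((f i : evenPart) : Lp ℂ 2 (volume : Measure ℝ)), (scalingOp g ∘L ((1 - shellProj (p : ℝ)⁻¹ 1) ∘L (dualCutoffProj ∅ M ∘L (annulusProj p 1 ∘L scalingUnitary m)))) ((f i : evenPart) : Lp ℂ 2 (volume : Measure ℝ))⟫_ℂ‖ := by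
      refine Summable.of_norm_bounded h123 fun i => ?_
      rw [norm_norm]
      exact hb i
    refine ⟨hO, ?_⟩
    calc ∑' i, ‖⟪((f i : evenPart) : Lp ℂ 2 (volume : Measure ℝ)), (scalingOp g ∘L ((1 - shellProj (p : ℝ)⁻¹ 1) ∘L (dualCutoffProj ∅ M ∘L (annulusProj p 1 ∘L scalingUnitary m)))) ((f i : evenPart) : Lp ℂ 2 (volume : Measure ℝ))⟫_ℂ‖
        ≤ ∑' i, (‖⟪((f i : evenPart) : Lp ℂ 2 (volume : Measure ℝ)), (scalingOp g ∘L (shellProj ((p : ℝ)⁻¹ * Real.exp (-δ)) (p : ℝ)⁻¹ ∘L (dualCutoffProj ∅ M ∘L (annulusProj p 1 ∘L scalingUnitary m)))) ((f i : evenPart) : Lp ℂ 2 (volume : Measure ℝ))⟫_ℂ‖ + ‖⟪((f i : evenPart) : Lp ℂ 2 (volume : Measure ℝ)), (scalingOp g ∘L (shellProj 1 (Real.exp δ) ∘L (dualCutoffProj ∅ M ∘L (annulusProj p 1 ∘L scalingUnitary m)))) ((f i : evenPart) : Lp ℂ 2 (volume : Measure ℝ))⟫_ℂ‖ + ‖⟪((f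 i : evenPart) : Lp ℂ 2 (volume : Measure ℝ)), (scalingOp g ∘L ((1 - shellProj ((p : ℝ)⁻¹ * Real.exp (-δ)) (Real.exp δ)) ∘L (dualCutoffProj ∅ M ∘L (annulusProj p 1 ∘L scalingUnitary m)))) ((f i : evenPart) : Lp ℂ 2 (volume : Measure ℝ))⟫_ℂ‖) := Summable.tsum_le_tsum hb hO h123
      _ = (∑' i, ‖⟪((f i : evenPart) : Lp ℂ 2 (volume : Measure ℝ)), (scalingOp g ∘L (shellProj ((p : ℝ)⁻¹ * Real.exp (-δ)) (p : ℝ)⁻¹ ∘L (dualCutoffProj ∅ M ∘L (annulusProj p 1 ∘L scalingUnitary m)))) ((f i : evenPart) : Lp ℂ 2 (volume : Measure ℝ))⟫_ℂ‖) + (∑' i, ‖⟪((f i : evenPart) : Lp ℂ 2 (volume : Measure ℝ)), (scalingOp g ∘L (shellProj 1 (Real.exp δ) ∘L (dualCutoffProj ∅ M ∘L (annulusProj p 1 ∘L scalingUnitary m)))) ((f i : evenPart) : Lp ℂ 2 (volume : Measure ℝ))⟫_ℂ‖) + ∑' i, ‖⟪((f i : evenPart) : Lp ℂ 2 (volume :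 Measure ℝ)), (scalingOp g ∘L ((1 - shellProj ((p : ℝ)⁻¹ * Real.exp (-δ)) (Real.exp δ)) ∘L (dualCutoffProj ∅ M ∘L (annulusProj p 1 ∘L scalingUnitary m)))) ((f i : evenPart) : Lp ℂ 2 (volume : Measure ℝ))⟫_ℂ‖ := by
          rw [(h1.1.add h2.1).tsum_add h3.1, h1.1.tsum_add h2.1]
      _ ≤ Cin * ‖(dualCutoffProj ∅ M ∘L (annulusProj p 1 ∘L scalingUnitary m))‖ + Cout * ‖(dualCutoffProj ∅ M ∘L (annulusProj p 1 ∘L scalingUnitary m))‖ + C := add_le_add (add_le_add h1.2 h2.2) h3.2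
      _ ≤ Cin + Cout + C := by nlinarith [hYn M m, hCin0, hCout0, norm_nonneg (dualCutoffProj ∅ M ∘L (annulusProj p 1 ∘L scalingUnitary m))]
  · -- (O0)
    intro M m ι' f ι'' f'
    have h1 := hIn (dualCutoffProj ∅ M ∘L (annulusProj p 1 ∘L scalingUnitary m)) ι' f
    have h2 := hOut (dualCutoffProj ∅ M ∘L (annulusProj p 1 ∘L scalingUnitary m)) ι' f
    have h3 := hS1 M m ι' f
    have h1' := hIn (dualCutoffProj ∅ M ∘L (annulusProj p 1 ∘L scalingUnitary m)) ι'' f'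
    have h2' := hOut (dualCutoffProj ∅ M ∘L (annulusProj p 1 ∘L scalingUnitary m)) ι'' f'
    have h3' := hS1 M m ι'' f'
    simp_rw [hdec]
    rw [((Summable.of_norm h1.1).add (Summable.of_norm h2.1)).tsum_add (Summable.of_norm h3.1),
      (Summable.of_norm h1.1).tsum_add (Summable.of_norm h2.1),
      ((Summable.of_norm h1'.1).add (Summable.of_norm h2'.1)).tsum_add (Summable.of_norm h3'.1),
      (Summable.of_norm h1'.1).tsum_add (Summable.of_norm h2'.1),
      tsum_inner_scalingOp_shellProj_eq_of_hilbertBasis hg.1 hg.2 hin hin' ((dualCutoffProj ∅ M ∘L (annulusProj p 1 ∘L scalingUnitary m))) f f',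
      tsum_inner_scalingOp_shellProj_eq_of_hilbertBasis hg.1 hg.2 one_pos heδ' ((dualCutoffProj ∅ M ∘L (annulusProj p 1 ∘L scalingUnitary m))) f f', hS0 M m ι' f ι'' f']
  · -- (O2)
    intro m ι' f
    have hlim1 := tendsto_tsum_inner_ring_real p hg hin hin' hQin m f
    have hlim2 := tendsto_tsum_inner_ring_real p hg one_pos heδ' hQout m f
    have hlim3 := hS2 m ι' f
    have h := (hlim1.add hlim2).add hlim3
    rw [add_zero, add_zero] at h
    refine h.congr' (Eventually.of_forall fun M => ?_)
    have h1 := hIn (dualCutoffProj ∅ M ∘L (annulusProj p 1 ∘L scalingUnitary m)) ι' f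
    have h2 := hOut (dualCutoffProj ∅ M ∘L (annulusProj p 1 ∘L scalingUnitary m)) ι' f
    have h3 := hS1 M m ι' f
    simp_rw [hdec]
    rw [((Summable.of_norm h1.1).add (Summable.of_norm h2.1)).tsum_add (Summable.of_norm h3.1),
      (Summable.of_norm h1.1).tsum_add (Summable.of_norm h2.1)]


/-! ## §4. The real-shift family package (W1), (W0), (W2) -/

/-- **The one-parameter family with a real shift.**  For a Weil test function `g` and a prime `p` there is `C`
such that for every `M`, every `t ∈ ℝ` and every Hilbert basis `(f_i)` of `L²(ℝ)_ev`: (W1) the diagonal series of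
`ϑ(g) P̂⁰_M Q₀(1) ϑ_t` is absolutely summable with `Σ_i |d_g(P̂⁰_M Q₀ ϑ_t, f_i)| ≤ C`; (W0) its sum does not
depend on the basis; (W2) `Σ_i d_g(P̂⁰_M Q₀ ϑ_t, f_i) → log p · g(−t)` as `M → ∞`. [cite: Connes1999, §VII Thm 4 and proof eqs. (29)–(33) (arXiv p0013); ReedSimon1972, Thm. VI.22 and VI.24, PDF pp. 198–199] -/
theorem family_real {g : ℝ → ℂ} (hg : IsWeilTest g) :
    ∃ C : ℝ,
    (∀ (M t : ℝ) (ι : Type) (f : HilbertBasis ι ℂ (evenPart : Submodule ℂ (Lp ℂ 2 (volume : Measure ℝ)))),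
      Summable (fun i => ‖diagCoeff g (dualCutoffProj ∅ M * annulusProj p 1 * scalingUnitary t)
        ((f i : evenPart) : Lp ℂ 2 (volume : Measure ℝ))‖) ∧
      ∑' i, ‖diagCoeff g (dualCutoffProj ∅ M * annulusProj p 1 * scalingUnitary t)
        ((f i : evenPart) : Lp ℂ 2 (volume : Measure ℝ))‖ ≤ C) ∧
    (∀ (M t : ℝ) (ι : Type) (f : HilbertBasis ι ℂ (evenPart : Submodule ℂ (Lp ℂ 2 (volume : Measure ℝ))))
      (ι' : Type) (f' : HilbertBasis ι' ℂ (evenPart : Submodule ℂ (Lp ℂ 2 (volume : Measure ℝ)))),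
      ∑' i, diagCoeff g (dualCutoffProj ∅ M * annulusProj p 1 * scalingUnitary t)
          ((f i : evenPart) : Lp ℂ 2 (volume : Measure ℝ)) =
        ∑' i, diagCoeff g (dualCutoffProj ∅ M * annulusProj p 1 * scalingUnitary t)
          ((f' i : evenPart) : Lp ℂ 2 (volume : Measure ℝ))) ∧
    (∀ (t : ℝ) (ι : Type) (f : HilbertBasis ι ℂ (evenPart : Submodule ℂ (Lp ℂ 2 (volume : Measure ℝ)))),
      Tendsto (fun M : ℝ => ∑' i,
          diagCoeff g (dualCutoffProj ∅ M * annulusProj p 1 * scalingUnitary t)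
            ((f i : evenPart) : Lp ℂ 2 (volume : Measure ℝ)))
        atTop (𝓝 ((Real.log p : ℂ) * g (-t)))) := by
  have hp0 : (0 : ℝ) < p := by exact_mod_cast hp.out.pos
  have ha : (0 : ℝ) < (p : ℝ)⁻¹ := inv_pos.mpr hp0
  have hab : (p : ℝ)⁻¹ ≤ 1 := inv_le_one_of_one_le₀ (by exact_mod_cast hp.out.one_lt.le)
  obtain ⟨CS, hS1, hS0, hS2⟩ := separatedRemainder_real p hg one_pos
  obtain ⟨C', hO1, hO0, hO2⟩ := offShell_real_of_separated p hg one_pos hS1 hS0 hS2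
  -- the shell part
  obtain ⟨C, hC0, hSh⟩ := exists_bound_tsum_norm_inner_scalingOp_shellProj hg.1 hg.2 ha hab
  set Y : ℝ → ℝ → (Lp ℂ 2 (volume : Measure ℝ) →L[ℂ] Lp ℂ 2 (volume : Measure ℝ)) :=
    fun M t => dualCutoffProj ∅ M ∘L (annulusProj p 1 ∘L scalingUnitary t) with hY
  have hYle : ∀ M t, ‖Y M t‖ ≤ 1 := fun M t => norm_family_le_one_real p M t
  have hsplit : ∀ (M t : ℝ) (e : Lp ℂ 2 (volume : Measure ℝ)),
      diagCoeff g (dualCutoffProj ∅ M * annulusProj p 1 * scalingUnitary t) e =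
        ⟪e, (scalingOp g ∘L (shellProj (p : ℝ)⁻¹ 1 ∘L Y M t)) e⟫_ℂ +
        ⟪e, (scalingOp g ∘L ((1 - shellProj (p : ℝ)⁻¹ 1) ∘L Y M t)) e⟫_ℂ :=
    fun M t e => diagCoeff_family_eq_shell_add_offShell_real p g (shellProj (p : ℝ)⁻¹ 1) M t e
  refine ⟨C + C', ?_, ?_, ?_⟩
  · intro M t ι' f
    obtain ⟨hs1, hs2⟩ := hSh (Y M t) ι' f
    obtain ⟨ho1, ho2⟩ := hO1 M t ι' f
    simp_rw [hsplit]
    have hle := fun i => norm_add_le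
      ⟪((f i : evenPart) : Lp ℂ 2 (volume : Measure ℝ)), (scalingOp g ∘L (shellProj (p : ℝ)⁻¹ 1 ∘L Y M t))
        ((f i : evenPart) : Lp ℂ 2 (volume : Measure ℝ))⟫_ℂ
      ⟪((f i : evenPart) : Lp ℂ 2 (volume : Measure ℝ)), (scalingOp g ∘L ((1 - shellProj (p : ℝ)⁻¹ 1) ∘L Y M t))
        ((f i : evenPart) : Lp ℂ 2 (volume : Measure ℝ))⟫_ℂ
    refine ⟨Summable.of_nonneg_of_le (fun _ => norm_nonneg _) hle (hs1.add ho1), ?_⟩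
    refine ((Summable.of_nonneg_of_le (fun _ => norm_nonneg _) hle (hs1.add ho1)).tsum_le_tsum hle
      (hs1.add ho1)).trans ?_
    rw [hs1.tsum_add ho1]
    have h1 : C * ‖Y M t‖ ≤ C := by nlinarith [hYle M t, norm_nonneg (Y M t)]
    linarith
  · intro M t ι' f ι'' f'
    simp_rw [hsplit]
    rw [(Summable.of_norm (hSh (Y M t) ι' f).1).tsum_add (Summable.of_norm (hO1 M t ι' f).1),
      (Summable.of_norm (hSh (Y M t) ι'' f').1).tsum_add (Summable.of_norm (hO1 M t ι'' f').1),
      tsum_inner_scalingOp_shellProj_eq_of_hilbertBasis hg.1 hg.2 ha hab (Y M t) f f', hO0 M t ι' f ι'' f']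
  · intro t ι' f
    have hfun : (fun M : ℝ => ∑' i,
          diagCoeff g (dualCutoffProj ∅ M * annulusProj p 1 * scalingUnitary t)
            ((f i : evenPart) : Lp ℂ 2 (volume : Measure ℝ))) =
        fun M : ℝ => (∑' i, ⟪((f i : evenPart) : Lp ℂ 2 (volume : Measure ℝ)),
            (scalingOp g ∘L (shellProj (p : ℝ)⁻¹ 1 ∘L Y M t)) ((f i : evenPart) : Lp ℂ 2 (volume : Measure ℝ))⟫_ℂ) +
          ∑' i, ⟪((f i : evenPart) : Lp ℂ 2 (volume : Measure ℝ)),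
            (scalingOp g ∘L ((1 - shellProj (p : ℝ)⁻¹ 1) ∘L Y M t)) ((f i : evenPart) : Lp ℂ 2 (volume : Measure ℝ))⟫_ℂ := by
      funext M
      simp_rw [hsplit]
      exact (Summable.of_norm (hSh (Y M t) ι' f).1).tsum_add (Summable.of_norm (hO1 M t ι' f).1)
    rw [hfun, ← annulusValue_real p hg t ι' f, ← add_zero (∑' i, ⟪((f i : evenPart) : Lp ℂ 2 (volume : Measure ℝ)),
      (scalingOp g ∘L (shellProj (p : ℝ)⁻¹ 1 ∘L (annulusProj p 1 ∘L scalingUnitary t)))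
        ((f i : evenPart) : Lp ℂ 2 (volume : Measure ℝ))⟫_ℂ)]
    exact (tendsto_tsum_inner_scalingOp_shellProj_dualCutoff hg.1 hg.2 ha hab
      (annulusProj p 1 ∘L scalingUnitary t) f).add (hO2 t ι' f)

end Literature.NumberTheory.Connes2026
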